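/-
Copyright (c) 2026 the pub-hodgecm-mathlib formalisation cell (harness21).  Prover seat hodgecm-mathlib-K2E2-p12 (g5): Track B «K2-LIT», ENGINE E1,
h413 = stmt-HodgeConjecture-24833; (q10) «R7₃-SCALAR» dictionary brick for FILE 3 (census memo `CENSUS-q10-R73-SCALAR-U3.K2E1b-plan-g5.md` §3 (b):
«the ±1 DICTIONARY needed to match §1's local factors (= −1 at inert v, = +1 at split v)»).
-/
import Literature.NumberTheory.Rogawski1990.FinExplicitTransferFactorInertPlaceValuation   -- ★ brings `quadraticHeckeChar_localUnits` (= Hilbert symbol), `hilbertSymbol_eq_neg_one_of_odd_of_isUnramifiedIn`, `not_isSquare_delta_sq_of_nonsplit`, `cmQuadraticGenerator_spec`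
import Literature.NumberTheory.GelbartRogawski1991.LocalUnitarySplitPlaceDarboux           -- ★ `splitSqrt`, `splitSqrt_mul_self` (the square root of `d` in `F_v` at a split place)
import Literature.NumberTheory.Automorphic.QuadraticHeckeCharacter                         -- ★ `valueAtUniformizer_quadraticHeckeChar_of_isSquare`
import HarnessLib

/-!
# K2·E1 — `K2E1QuadraticHeckeCharCMPlaceValues`: THE VALUES OF `ε_{L∕L⁺}` AT UNIFORMIZERS — `ε(ϖ_v) = −1` AT AN INERT UNRAMIFIED PLACE, `= +1` AT A SPLIT PLACE
# (the `±1` dictionary that matches ★ FILE 1's Euler factor `(1 − ε_v q_v^{−s})` with ★ FILE 2's inert ∕ split local factors of the `U(2,1)` intertwining scalar)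

Track B ∕ K2-LIT, crux h413 = `stmt-HodgeConjecture-24833`, route of record `HCCMUnconditional`; cell `hodgecm-mathlib`, squad K2, ENGINE E1 (campaign «EIS-RANK-ONE», (q10)
«R7₃-SCALAR»: census memo of K2E1b-plan (g5) §3 (b)).  THEOREMS ONLY (no `def`, no instance, no notation, no named-fact hypothesis, no `sorry`; default heartbeats); lane
`--supports stmt-HodgeConjecture-24833 --as helper` (count-neutral).

THE MATHEMATICS [NeukirchANT1999, Ch. V (3.1), Ch. VI (5.2); Omeara1963, §63C 63:16; CasselsFrohlichANT1967, Ch. II §10].  `L` a CM field, `L⁺` its maximal totally real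
subfield, `c` complex conjugation, `ε = ε_{L∕L⁺} =` ★ `quadraticHeckeCharCM L` — the quadratic Hecke character of `L⁺` cutting out `L = L⁺(√θ)`, `θ =` ★ `cmQuadraticGenerator L`
(`α² = θ`, `cα = −α`, ★ `cmQuadraticGenerator_spec`), whose local component at `v` on `L⁺_vˣ` is the Hilbert symbol `(·, θ)_v` (★ `quadraticHeckeChar_localUnits`); its value at
the chosen uniformizer `ϖ_v` is `ε.valueAtUniformizer v` (★ `HeckeCharacter.valueAtUniformizer`), the number entering ★ `partialStandardL S (fun v => {ε.valueAtUniformizer v})`.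
* §1 **`valueAtUniformizer_quadraticHeckeCharCM_of_nonsplit`** — at a finite place `v` of `L⁺` UNRAMIFIED in `L` and NON-SPLIT (`c • w = w` for the place `w ∣ v`):
  `ε(ϖ_v) = −1` (`θ` is a non-square unit at `v` ★ `not_isSquare_delta_sq_of_nonsplit`, `ord_v ϖ_v = 1` is odd, ★ `hilbertSymbol_eq_neg_one_of_odd_of_isUnramifiedIn` — O'Meara 63:16).
* §2 **`valueAtUniformizer_quadraticHeckeCharCM_of_split`** — at a SPLIT place (`c • w ≠ w`): `ε(ϖ_v) = +1` (`θ = δ_w²` is a square in `L⁺_v`, ★ `splitSqrt_mul_self`; ★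
  `valueAtUniformizer_quadraticHeckeChar_of_isSquare`).
So in ★ `K2E1IntertwiningScalarContinuationU3.hasProd_localScalar_three_cm` the `v`-factor is ★ `K2E1IntertwiningLocalFactorU3`'s inert shape (`ε_v = −1`) resp. split shape
(`ε_v = +1`) — the junction FILE 3 needs.
HONEST LABEL: HC_CM is proved only modulo the 7 printed citations (2 remaining named inputs: hLiu418 = `stmt-HodgeConjecture-24832`, h413 = `stmt-HodgeConjecture-24833`) until rung 0
closes; this file asserts no named fact and closes no socket; count-neutral.

## References
* [NeukirchANT1999] J. Neukirch, *Algebraic Number Theory* (1999): Ch. V (3.1) (the Hilbert symbol at an unramified place), Ch. VI (5.2)–(5.3).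
* [Omeara1963] O. T. O'Meara, *Introduction to Quadratic Forms* (1963): §63C Example 63:16.
* [CasselsFrohlichANT1967] J. W. S. Cassels, A. Fröhlich (eds.), *Algebraic Number Theory* (1967): Ch. II §10, Ch. VI (Tate) §2.5.
-/

set_option autoImplicit false
set_option linter.dupNamespace false -- the mandated namespace repeats `HodgeConjecture.HodgeConjecture`

noncomputable section

open NumberField IsDedekindDomain
open scoped NNReal
open Literature.NumberTheory.Automorphic Literature.NumberTheory.Automorphic.UnitaryGroup Literature.NumberTheory.GaloisRepresentations
open Literature.NumberTheory.QuadraticForms Literature.NumberTheory.NumberFields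
open Literature.NumberTheory.GelbartRogawski1991.UnitaryDualPair.LocalSplitting (splitSqrt splitSqrt_mul_self)
open Literature.NumberTheory.Automorphic.Liu2021.LemD1IndexedNonVacuityNonsplitPlace (not_isSquare_delta_sq_of_nonsplit)

namespace Summit.HodgeConjecture.HodgeConjecture.Cruxes.H413.K2E1QuadraticHeckeCharCMPlaceValues

variable (L : Type) [Field L] [NumberField L] [IsCMField L] (v : HeightOneSpectrum (𝓞 ↥(maximalRealSubfield L))) (w : PlacesOver L v)

/-! ## §1 Inert unramified places: `ε(ϖ_v) = −1` -/

/-- **`ε_{L∕L⁺}(ϖ_v) = −1` AT AN INERT UNRAMIFIED PLACE.**  For a CM field `L`, a finite place `v` of `L⁺` unramified in `L` with a `c`-fixed place `w ∣ v` (non-split), the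
quadratic character `ε = quadraticHeckeCharCM L` has `ε.valueAtUniformizer v = −1`: its local component is the Hilbert symbol `(·, θ)_v` (★ `quadraticHeckeChar_localUnits`),
`θ` is a non-square at `v` (★ `not_isSquare_delta_sq_of_nonsplit`), and `(ϖ_v, θ)_v = −1` for the unramified non-square unit class `θ` and `ord_v ϖ_v = 1` odd (★
`hilbertSymbol_eq_neg_one_of_odd_of_isUnramifiedIn`).  This is the `ε_v = −1` of ★ FILE 2's inert local factor. [cite: Omeara1963, §63C Example 63:16] [cite: NeukirchANT1999, Ch. V (3.1)] -/
theorem valueAtUniformizer_quadraticHeckeCharCM_of_nonsplit (hw : IsCMField.complexConj L • w.1 = w.1) (hunr : Algebra.IsUnramifiedIn (𝓞 L) v.asIdeal) :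
    (quadraticHeckeCharCM L).valueAtUniformizer v = -1 := by
  haveI : Algebra.IsQuadraticExtension ↥(maximalRealSubfield L) L := IsCMField.isQuadraticExtension L
  obtain ⟨α, hα0, hcα, hsq⟩ := cmQuadraticGenerator_spec L
  have hθ : α * α = algebraMap ↥(maximalRealSubfield L) L (cmQuadraticGenerator L : ↥(maximalRealSubfield L)) := by rw [← sq]; exact hsq
  set π : (v.adicCompletion ↥(maximalRealSubfield L))ˣ := HeckeCharacter.uniformizer ↥(maximalRealSubfield L) v with hπdef
  have hodd : Odd (WithZero.log (Valued.v (π : v.adicCompletion ↥(maximalRealSubfield L)))) := by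
    rw [hπdef, HeckeCharacter.valued_uniformizer, WithZero.log_exp]
    exact ⟨-1, by norm_num⟩
  rw [HeckeCharacter.valueAtUniformizer, HeckeCharacter.localComponent_apply, quadraticHeckeCharCM_def,
    quadraticHeckeChar_localUnits (not_isSquare_cmQuadraticGenerator L) v π,
    hilbertSymbol_eq_neg_one_of_odd_of_isUnramifiedIn ↥(maximalRealSubfield L) v hsq (algebraMap_ne_of_complexConj_eq_neg hcα hα0) hunr
      (not_isSquare_delta_sq_of_nonsplit L v (IsCMField.complexConj L) hcα hα0 w hw hθ) π.ne_zero hodd,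
    Int.cast_neg, Int.cast_one]

/-! ## §2 Split places: `ε(ϖ_v) = +1` -/

/-- **`ε_{L∕L⁺}(ϖ_v) = +1` AT A SPLIT PLACE.**  If `v` splits in `L` (`c • w ≠ w` for a place `w ∣ v`), then `θ = δ_w²` is a square in `L⁺_v` (the square root `δ_w =` ★ `splitSqrt`
attached to `w`, ★ `splitSqrt_mul_self`), so `ϖ_v` is a local norm and `ε.valueAtUniformizer v = 1` (★ `valueAtUniformizer_quadraticHeckeChar_of_isSquare`).  This is the
`ε_v = +1` of ★ FILE 2's split local factor (Gindikin–Karpelevich for `GL₃`). [cite: NeukirchANT1999, Ch. V (3.1)] [cite: CasselsFrohlichANT1967, Ch. II §10] -/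
theorem valueAtUniformizer_quadraticHeckeCharCM_of_split (hw : IsCMField.complexConj L • w.1 ≠ w.1) :
    (quadraticHeckeCharCM L).valueAtUniformizer v = 1 := by
  haveI : Algebra.IsQuadraticExtension ↥(maximalRealSubfield L) L := IsCMField.isQuadraticExtension L
  obtain ⟨α, hα0, hcα, hsq⟩ := cmQuadraticGenerator_spec L
  have hθ : α * α = algebraMap ↥(maximalRealSubfield L) L (cmQuadraticGenerator L : ↥(maximalRealSubfield L)) := by rw [← sq]; exact hsq
  have hss := splitSqrt_mul_self ↥(maximalRealSubfield L) L (IsCMField.complexConj L) hcα hα0 hθ v w hw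
  rw [quadraticHeckeCharCM_def]
  exact valueAtUniformizer_quadraticHeckeChar_of_isSquare (not_isSquare_cmQuadraticGenerator L) ⟨_, hss.symm⟩

end Summit.HodgeConjecture.HodgeConjecture.Cruxes.H413.K2E1QuadraticHeckeCharCMPlaceValues

end
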